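import Summits.QuantumFields.YangMills.Theorems.BalabanUVNodesN15KingModelProperTimeRepresentation
import Mathlib.Analysis.InnerProductSpace.PiL2

/-!
# BalabanUVNodes ∕ N15 — THE KING-MODEL RUNG (PART Ϻ-c): COMPARISON OF KING's CONTINUUM BLOCK TWO-POINT FUNCTION WITH THE CONTINUUM FREE PROPAGATOR —
# `C_m(R₊(z)) ≤ S₂^{ℝ}(z) ≤ C_m(R₋(z))`, `C_m(R) = ∫₀^∞ e^{−tm²}(4πt)^{−(d+1)∕2}e^{−R²∕4t}dt` the free massive propagator at Euclidean distance `R` in proper-time form,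
# `R₋(z) = ‖(|z|−1)₊‖₂` ∕ `R₊(z) = ‖|z|+1‖₂` the smallest ∕ largest distance between the unit blocks at `0` and at `z`
# (Track A, DAG node N15 = NE2; FAN-OUT v1.1 §N15 s3 «KING-MODEL RUNG»; uses parts Ϻ-a∕Ϻ-b; count-neutral)

HONEST FRAMING.  Count-neutral (cell `pub-ymgap`, seat `pub-ymgap-dag-n15-e` g35; `--supports stmt-QuantumFields-27366 --as helper` = K3⁸).  King's `A = 0`, `g = 0` model
([King1986] C. King, Commun. Math. Phys. **102** (1986) 649–677).  Part Ϻ-b wrote the continuum block two-point function of Theorem 2.1's limit in heat-kernel form,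
`S₂^{ℝ}(z) = ∫₀^∞e^{−tm²}Π_μ J_t(z_μ)dt`, `J_t(x) = ∫Λ(u)g_t(x−u)du` (`Λ = (1−|u|)₊`, `g_t(a) = (4πt)^{−1∕2}e^{−a²∕4t}`).  Since `Λ` is a probability density supported in
`[−1,1]` and `g_t` decreases in `|a|`, part Ϻ-a's envelopes give `g_t(|x|+1) ≤ J_t(x) ≤ g_t((|x|−1)₊)`; multiplying over the coordinates,
`Π_μ g_t(w_μ) = (4πt)^{−(d+1)∕2}e^{−|w|²∕4t} =: k_t(|w|)` (`heatRadial`) turns the two envelopes into the `(d+1)`-dimensional heat kernel at the Euclidean radii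
`R₊(z) = (Σ_μ(|z_μ|+1)²)^{1∕2}` (`blockSpan`) and `R₋(z) = (Σ_μ(|z_μ|−1)₊²)^{1∕2}` (`blockGap`) — the largest and the smallest distance between a point of the unit block at
`0` and a point of the unit block at `z` — and integrating against `e^{−tm²}dt`: ★★★ `C_m(R₊(z)) ≤ S₂^{ℝ}(z) ≤ C_m(R₋(z))` with
`C_m(R) := ∫₀^∞e^{−tm²}k_t(R)dt` (`freePropRadial`) = the continuum free massive propagator `(−Δ+m²)⁻¹(x,y)` at `|x−y| = R` in Schwinger's proper-time form (finite iff
`R > 0` when `d ≥ 1`; the upper bound is stated for `R₋(z) > 0`, i.e. some `|z_μ| ≥ 2`).  This is the BLOCK-MONOTONICITY reading of (2.22): the block average of a radially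
decreasing kernel lies between its values at the extreme distances.  Also: `C_m` is positive and decreasing, `k_t(R) ≤ (√((d+1)∕π)∕(2R))^{d+1}` uniformly in `t`
(so `C_m(R) ≤ (√((d+1)∕π)∕(2R))^{d+1}∕m²`), and `R₋(z) ≥ ‖z‖₂ − √(d+1)`, `R₊(z) ≤ ‖z‖₂ + √(d+1)` (Minkowski in `EuclideanSpace ℝ (Fin (d+1))`).  NOT Bałaban's objects;
NOT a node discharge; nothing continuum-Yang–Mills ∕ `ℝ⁴` ∕ OS ∕ Clay — «m» is the free field's mass.  0 `sorry`; standard axioms; FOUR definitions (`heatRadial`,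
`freePropRadial`, `blockGap`, `blockSpan`).

WHAT THIS FILE PROVES (kernel).  §1 `heatRadial` (+ `_pos`, `_nonneg`, ★ `heatRadial_anti`, `prod_gaussLine_eq`, ★ `prod_gaussLine_eq_heatRadial`, ★ `heatRadial_le_inv_pow` (uniform bound)).
§2 `tentAvg_nonneg`, ★ `tentAvg_le_gaussLine_posPart`, ★ `gaussLine_le_tentAvg`, `blockGap`∕`blockSpan` (+ `_nonneg`, `blockSpan_pos`, `blockGap_pos_of_two_le`), ★★ `prod_tentAvg_le_heatRadial`,
★★ `heatRadial_le_prod_tentAvg`.  §3 `freePropRadial`, `measurable_heatRadial`, ★ `integrableOn_exp_mul_heatRadial` (`R > 0`), ★ `freePropRadial_pos`, ★ `freePropRadial_anti`,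
`freePropRadial_le_inv_pow_div`.  §4 `integrableOn_tentForm`, ★★★ **`kingS2Inf_le_freePropRadial`**, ★★★ **`freePropRadial_le_kingS2Inf`**, ★★ `kingS2Inf_sandwich`.
§5 `euclidNorm_intCast_eq`, ★ `blockSpan_le_norm_add`, ★ `norm_sub_le_blockGap`.

HONEST SCOPE.  King's free model, `m² > 0`, every `d`; `C_m` is displayed in proper-time form, not in Bessel closed form; the upper comparison needs `R₋(z) > 0`.  N15 untouched;
counts unmoved.  Locators (use): [King1986] Thm 2.1 (2.22) p.654, (4.5) p.670, Thm 3.3 (3.6) p.655.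
-/

noncomputable section

open scoped BigOperators Topology
open Filter MeasureTheory Set Function

namespace Summit.QuantumFields.YangMills.BalabanUVNodes.N15KingModelRung.ProperTime

open Summit.QuantumFields.YangMills.BalabanUVNodes.N15KingModelRung.OptimalDecay
open Literature.Analysis.Fourier (tent tent_nonneg)

variable {d : ℕ}

/-! ## §1 The radial heat kernel `k_t(R) = (4πt)^{−(d+1)∕2}e^{−R²∕4t}` -/

/-- The `(d+1)`-dimensional heat kernel as a function of the Euclidean radius: `k_t(R) = (4πt)^{−(d+1)∕2}·e^{−R²∕(4t)}`. [folklore] -/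
def heatRadial (d : ℕ) (t R : ℝ) : ℝ := ((Real.sqrt (4 * Real.pi * t))⁻¹) ^ (d + 1) * Real.exp (-(R ^ 2 / (4 * t)))

/-- `k_t(R) > 0` (`t > 0`). [folklore] -/
theorem heatRadial_pos {t : ℝ} (ht : 0 < t) (R : ℝ) : 0 < heatRadial d t R := by
  unfold heatRadial
  have : 0 < Real.sqrt (4 * Real.pi * t) := Real.sqrt_pos.mpr (by positivity)
  positivity

/-- `k_t(R) ≥ 0`. [folklore] -/
theorem heatRadial_nonneg (t R : ℝ) : 0 ≤ heatRadial d t R := by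
  unfold heatRadial
  exact mul_nonneg (pow_nonneg (inv_nonneg.mpr (Real.sqrt_nonneg _)) _) (Real.exp_nonneg _)

/-- ★ `k_t` is DECREASING in the radius on `[0,∞)` (`t > 0`). [folklore] -/
theorem heatRadial_anti {t : ℝ} (ht : 0 < t) {R R' : ℝ} (h0 : 0 ≤ R) (h : R ≤ R') : heatRadial d t R' ≤ heatRadial d t R := by
  unfold heatRadial
  refine mul_le_mul_of_nonneg_left (Real.exp_le_exp.mpr ?_) (pow_nonneg (inv_nonneg.mpr (Real.sqrt_nonneg _)) _)
  have h4 : 0 < 4 * t := by positivity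
  exact neg_le_neg (div_le_div_of_nonneg_right (pow_le_pow_left₀ h0 h 2) h4.le)

/-- `Π_μ g_t(w_μ) = (4πt)^{−(d+1)∕2}·e^{−Σ_μ w_μ²∕(4t)}` (the product of the line heat kernels is the `(d+1)`-dimensional one). [folklore] -/
theorem prod_gaussLine_eq (t : ℝ) (w : Fin (d + 1) → ℝ) :
    ∏ μ, gaussLine t (w μ) = ((Real.sqrt (4 * Real.pi * t))⁻¹) ^ (d + 1) * Real.exp (-((∑ μ, w μ ^ 2) / (4 * t))) := by
  unfold gaussLine
  rw [Finset.prod_mul_distrib, Finset.prod_const, Finset.card_univ, Fintype.card_fin, ← Real.exp_sum]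
  congr 2
  rw [Finset.sum_div, ← Finset.sum_neg_distrib]

/-- ★ `Π_μ g_t(w_μ) = k_t(‖w‖₂)`, `‖w‖₂ = (Σ_μ w_μ²)^{1∕2}`. [folklore] -/
theorem prod_gaussLine_eq_heatRadial (t : ℝ) (w : Fin (d + 1) → ℝ) : ∏ μ, gaussLine t (w μ) = heatRadial d t (Real.sqrt (∑ μ, w μ ^ 2)) := by
  rw [prod_gaussLine_eq, heatRadial, Real.sq_sqrt (Finset.sum_nonneg fun μ _ => sq_nonneg _)]

/-- The one-line letter: for `t > 0`, `a > 0`: `(4πt)^{−1∕2}e^{−a∕t} ≤ (2√a·√(4π))⁻¹` (`e^{−a∕t} ≤ t∕(t+a)` and `√t∕(t+a) ≤ 1∕(2√a)`). [folklore] -/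
theorem inv_sqrt_mul_exp_le {t a : ℝ} (ht : 0 < t) (ha : 0 < a) :
    (Real.sqrt (4 * Real.pi * t))⁻¹ * Real.exp (-(a / t)) ≤ (2 * Real.sqrt a * Real.sqrt (4 * Real.pi))⁻¹ := by
  have hπ : 0 < 4 * Real.pi := by positivity
  have hst : 0 < Real.sqrt t := Real.sqrt_pos.mpr ht
  have hsa : 0 < Real.sqrt a := Real.sqrt_pos.mpr ha
  have hs4 : 0 < Real.sqrt (4 * Real.pi) := Real.sqrt_pos.mpr hπ
  have hsplit : Real.sqrt (4 * Real.pi * t) = Real.sqrt (4 * Real.pi) * Real.sqrt t := Real.sqrt_mul hπ.le t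
  -- `e^{−a/t} ≤ t/(t+a)`
  have h1 : Real.exp (-(a / t)) ≤ t / (t + a) := by
    have h := Real.add_one_le_exp (a / t)
    rw [Real.exp_neg, inv_le_comm₀ (Real.exp_pos _) (by positivity)]
    calc (t / (t + a))⁻¹ = (t + a) / t := by rw [inv_div]
      _ = a / t + 1 := by field_simp; ring
      _ ≤ Real.exp (a / t) := h
  -- `√t/(t+a) ≤ 1/(2√a)`
  have h2 : Real.sqrt t / (t + a) ≤ (2 * Real.sqrt a)⁻¹ := by
    rw [div_le_iff₀ (by positivity), ← div_eq_inv_mul, le_div_iff₀ (by positivity)]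
    nlinarith [sq_nonneg (Real.sqrt t - Real.sqrt a), Real.sq_sqrt ht.le, Real.sq_sqrt ha.le]
  calc (Real.sqrt (4 * Real.pi * t))⁻¹ * Real.exp (-(a / t))
      ≤ (Real.sqrt (4 * Real.pi * t))⁻¹ * (t / (t + a)) := mul_le_mul_of_nonneg_left h1 (inv_nonneg.mpr (Real.sqrt_nonneg _))
    _ = (Real.sqrt (4 * Real.pi))⁻¹ * (Real.sqrt t / (t + a)) := by
        have key : (Real.sqrt t)⁻¹ * t = Real.sqrt t := by
          rw [inv_mul_eq_iff_eq_mul₀ hst.ne', Real.mul_self_sqrt ht.le]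
        rw [hsplit, mul_inv, div_eq_mul_inv, div_eq_mul_inv, mul_assoc, ← mul_assoc (Real.sqrt t)⁻¹ t, key]
    _ ≤ (Real.sqrt (4 * Real.pi))⁻¹ * (2 * Real.sqrt a)⁻¹ := mul_le_mul_of_nonneg_left h2 (inv_nonneg.mpr (Real.sqrt_nonneg _))
    _ = (2 * Real.sqrt a * Real.sqrt (4 * Real.pi))⁻¹ := by rw [← mul_inv, mul_comm]

/-- ★ **Uniform bound on the heat kernel at a positive radius**: for `t > 0`, `R > 0`,
`k_t(R) ≤ ((2√(R²∕(4(d+1)))·√(4π))⁻¹)^{d+1}` (`= (√((d+1)∕π)∕(2R))^{d+1}`), uniformly in `t`. [folklore] -/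
theorem heatRadial_le_inv_pow {t R : ℝ} (ht : 0 < t) (hR : 0 < R) :
    heatRadial d t R ≤ ((2 * Real.sqrt (R ^ 2 / (4 * (d + 1))) * Real.sqrt (4 * Real.pi))⁻¹) ^ (d + 1) := by
  set a : ℝ := R ^ 2 / (4 * (d + 1)) with ha_def
  have ha : 0 < a := by positivity
  have hsplit : Real.exp (-(R ^ 2 / (4 * t))) = Real.exp (-(a / t)) ^ (d + 1) := by
    rw [← Real.exp_nat_mul]
    congr 1
    rw [ha_def]
    push_cast
    field_simp
  unfold heatRadial
  rw [hsplit, ← mul_pow]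
  exact pow_le_pow_left₀ (mul_nonneg (inv_nonneg.mpr (Real.sqrt_nonneg _)) (Real.exp_nonneg _)) (inv_sqrt_mul_exp_le ht ha) _

/-! ## §2 The per-coordinate envelopes in tent form and the two block radii -/

/-- `J_t(x) = ∫Λ(u)g_t(x−u)du ≥ 0`. [folklore] -/
theorem tentAvg_nonneg (t x : ℝ) : 0 ≤ ∫ u : ℝ, tent 1 u * gaussLine t (x - u) :=
  integral_nonneg fun _ => mul_nonneg (tent_nonneg _ _) (gaussLine_nonneg _ _)

/-- `J_t(x) = I_t(x)∕(2π)`. [folklore] -/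
theorem tentAvg_eq_lineHeat_div {t : ℝ} (ht : 0 < t) (x : ℝ) : ∫ u : ℝ, tent 1 u * gaussLine t (x - u) = lineHeat t x / (2 * Real.pi) := by
  rw [lineHeat_eq_integral_tent ht x]
  field_simp

/-- ★ **Upper envelope**: `J_t(x) ≤ g_t((|x|−1)₊)` for every `x` (`|x| ≥ 1`: part Ϻ-a's envelope; `|x| < 1`: the peak). [folklore] -/
theorem tentAvg_le_gaussLine_posPart {t : ℝ} (ht : 0 < t) (x : ℝ) : ∫ u : ℝ, tent 1 u * gaussLine t (x - u) ≤ gaussLine t (max (|x| - 1) 0) := by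
  have hπ : 0 < 2 * Real.pi := by positivity
  rw [tentAvg_eq_lineHeat_div ht, div_le_iff₀ hπ]
  rcases le_or_gt 1 (|x|) with h | h
  · rw [max_eq_left (by linarith), mul_comm]
    exact lineHeat_le_envelope ht h
  · rw [max_eq_right (by linarith), mul_comm]
    exact lineHeat_le_peak ht x

/-- ★ **Lower envelope**: `g_t(|x|+1) ≤ J_t(x)`. [folklore] -/
theorem gaussLine_le_tentAvg {t : ℝ} (ht : 0 < t) (x : ℝ) : gaussLine t (|x| + 1) ≤ ∫ u : ℝ, tent 1 u * gaussLine t (x - u) := by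
  have hπ : 0 < 2 * Real.pi := by positivity
  rw [tentAvg_eq_lineHeat_div ht, le_div_iff₀ hπ, mul_comm]
  exact envelope_le_lineHeat ht x

/-- **The block gap** `R₋(z) = (Σ_μ (|z_μ|−1)₊²)^{1∕2}`: the smallest Euclidean distance between a point of the unit block `[0,1]^{d+1}` and a point of `z + [0,1]^{d+1}`. [folklore] -/
def blockGap (z : Fin (d + 1) → ℤ) : ℝ := Real.sqrt (∑ μ, (max (|(z μ : ℝ)| - 1) 0) ^ 2)

/-- **The block span** `R₊(z) = (Σ_μ (|z_μ|+1)²)^{1∕2}`: the largest Euclidean distance between a point of `[0,1]^{d+1}` and a point of `z + [0,1]^{d+1}`. [folklore] -/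
def blockSpan (z : Fin (d + 1) → ℤ) : ℝ := Real.sqrt (∑ μ, (|(z μ : ℝ)| + 1) ^ 2)

/-- `R₋(z) ≥ 0`. [folklore] -/
theorem blockGap_nonneg (z : Fin (d + 1) → ℤ) : 0 ≤ blockGap z := Real.sqrt_nonneg _

/-- `R₊(z) > 0`. [folklore] -/
theorem blockSpan_pos (z : Fin (d + 1) → ℤ) : 0 < blockSpan z := by
  unfold blockSpan
  refine Real.sqrt_pos.mpr (Finset.sum_pos (fun μ _ => by positivity) Finset.univ_nonempty)

/-- `R₋(z) ≤ R₊(z)`. [folklore] -/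
theorem blockGap_le_blockSpan (z : Fin (d + 1) → ℤ) : blockGap z ≤ blockSpan z := by
  unfold blockGap blockSpan
  refine Real.sqrt_le_sqrt (Finset.sum_le_sum fun μ _ => ?_)
  have h0 : 0 ≤ max (|(z μ : ℝ)| - 1) 0 := le_max_right _ _
  have h1 : max (|(z μ : ℝ)| - 1) 0 ≤ |(z μ : ℝ)| + 1 := max_le (by linarith [abs_nonneg (z μ : ℝ)]) (by positivity)
  exact pow_le_pow_left₀ h0 h1 2

/-- `R₋(z) > 0` as soon as some `|z_μ| ≥ 2`. [folklore] -/
theorem blockGap_pos_of_two_le {z : Fin (d + 1) → ℤ} {μ : Fin (d + 1)} (h : 2 ≤ |z μ|) : 0 < blockGap z := by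
  unfold blockGap
  refine Real.sqrt_pos.mpr (lt_of_lt_of_le ?_ (Finset.single_le_sum (f := fun ν => (max (|(z ν : ℝ)| - 1) 0) ^ 2) (fun ν _ => sq_nonneg _) (Finset.mem_univ μ)))
  have h' : (2 : ℝ) ≤ |(z μ : ℝ)| := by
    rw [← Int.cast_abs]; exact_mod_cast h
  have : 1 ≤ max (|(z μ : ℝ)| - 1) 0 := le_max_of_le_left (by linarith)
  positivity

/-- ★★ **Upper product envelope**: `Π_μ J_t(z_μ) ≤ k_t(R₋(z))` (`t > 0`). [folklore] -/
theorem prod_tentAvg_le_heatRadial {t : ℝ} (ht : 0 < t) (z : Fin (d + 1) → ℤ) :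
    ∏ μ, (∫ u : ℝ, tent 1 u * gaussLine t ((z μ : ℝ) - u)) ≤ heatRadial d t (blockGap z) := by
  unfold blockGap
  rw [← prod_gaussLine_eq_heatRadial]
  exact Finset.prod_le_prod (fun μ _ => tentAvg_nonneg _ _) fun μ _ => tentAvg_le_gaussLine_posPart ht _

/-- ★★ **Lower product envelope**: `k_t(R₊(z)) ≤ Π_μ J_t(z_μ)` (`t > 0`). [folklore] -/
theorem heatRadial_le_prod_tentAvg {t : ℝ} (ht : 0 < t) (z : Fin (d + 1) → ℤ) :
    heatRadial d t (blockSpan z) ≤ ∏ μ, (∫ u : ℝ, tent 1 u * gaussLine t ((z μ : ℝ) - u)) := by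
  unfold blockSpan
  rw [← prod_gaussLine_eq_heatRadial]
  exact Finset.prod_le_prod (fun μ _ => gaussLine_nonneg _ _) fun μ _ => gaussLine_le_tentAvg ht _

/-! ## §3 The continuum free propagator at radius `R` in proper-time form -/

/-- **THE CONTINUUM FREE MASSIVE PROPAGATOR AT EUCLIDEAN DISTANCE `R`** in Schwinger's proper-time form: `C_m(R) = ∫₀^∞ e^{−tm²}·(4πt)^{−(d+1)∕2}e^{−R²∕4t}dt`
(`= (−Δ+m²)⁻¹(x,y)` at `|x−y| = R` in `ℝ^{d+1}`; finite iff `R > 0` when `d ≥ 1`). [folklore] -/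
def freePropRadial (d : ℕ) (m2 R : ℝ) : ℝ := ∫ t in Ioi (0 : ℝ), Real.exp (-(t * m2)) * heatRadial d t R

/-- `t ↦ k_t(R)` is measurable. [folklore] -/
theorem measurable_heatRadial (R : ℝ) : Measurable fun t : ℝ => heatRadial d t R := by
  unfold heatRadial
  fun_prop

/-- ★ For `R > 0` and `m² > 0`, `t ↦ e^{−tm²}k_t(R)` is integrable on `(0,∞)` (majorant `K_R·e^{−tm²}` by the uniform bound). [folklore] -/
theorem integrableOn_exp_mul_heatRadial {m2 R : ℝ} (hm : 0 < m2) (hR : 0 < R) :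
    IntegrableOn (fun t : ℝ => Real.exp (-(t * m2)) * heatRadial d t R) (Ioi (0 : ℝ)) := by
  set K : ℝ := ((2 * Real.sqrt (R ^ 2 / (4 * (d + 1))) * Real.sqrt (4 * Real.pi))⁻¹) ^ (d + 1) with hK
  have hE : IntegrableOn (fun t : ℝ => Real.exp (-m2 * t) * K) (Ioi (0 : ℝ)) := (exp_neg_integrableOn_Ioi 0 hm).mul_const K
  refine hE.mono' (((by fun_prop : Measurable fun t : ℝ => Real.exp (-(t * m2))).mul (measurable_heatRadial R)).aestronglyMeasurable) ?_
  filter_upwards [ae_restrict_mem measurableSet_Ioi] with t ht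
  rw [Real.norm_eq_abs, abs_mul, Real.abs_exp, abs_of_nonneg (heatRadial_nonneg _ _), show -(t * m2) = -m2 * t by ring]
  exact mul_le_mul_of_nonneg_left (heatRadial_le_inv_pow ht hR) (Real.exp_nonneg _)

/-- ★ `C_m(R) > 0` (`R > 0`, `m² > 0`). [folklore] -/
theorem freePropRadial_pos {m2 R : ℝ} (hm : 0 < m2) (hR : 0 < R) : 0 < freePropRadial d m2 R := by
  unfold freePropRadial
  set f : ℝ → ℝ := fun t => Real.exp (-(t * m2)) * heatRadial d t R with hf
  have hpos : ∀ t : ℝ, 0 < t → 0 < f t := fun t ht => mul_pos (Real.exp_pos _) (heatRadial_pos ht _)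
  have hnn : 0 ≤ᵐ[volume.restrict (Ioi (0 : ℝ))] f := by
    filter_upwards [ae_restrict_mem measurableSet_Ioi] with t ht using (hpos t ht).le
  rw [setIntegral_pos_iff_support_of_nonneg_ae hnn (integrableOn_exp_mul_heatRadial hm hR)]
  refine lt_of_lt_of_le ?_ (measure_mono (fun t ht => ⟨(hpos t ht).ne', ht⟩ : Ioi (0 : ℝ) ⊆ support f ∩ Ioi 0))
  rw [Real.volume_Ioi]
  exact ENNReal.zero_lt_top

/-- ★ `C_m` is DECREASING on `(0,∞)`: `0 < R ≤ R' ⇒ C_m(R') ≤ C_m(R)`. [folklore] -/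
theorem freePropRadial_anti {m2 R R' : ℝ} (hm : 0 < m2) (hR : 0 < R) (h : R ≤ R') : freePropRadial d m2 R' ≤ freePropRadial d m2 R := by
  unfold freePropRadial
  refine setIntegral_mono_on (integrableOn_exp_mul_heatRadial hm (hR.trans_le h)) (integrableOn_exp_mul_heatRadial hm hR) measurableSet_Ioi fun t ht => ?_
  exact mul_le_mul_of_nonneg_left (heatRadial_anti ht hR.le h) (Real.exp_nonneg _)

/-- `C_m(R) ≤ K_R∕m²` with `K_R = ((2√(R²∕(4(d+1)))·√(4π))⁻¹)^{d+1}` (`R > 0`). [folklore] -/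
theorem freePropRadial_le_inv_pow_div {m2 R : ℝ} (hm : 0 < m2) (hR : 0 < R) :
    freePropRadial d m2 R ≤ ((2 * Real.sqrt (R ^ 2 / (4 * (d + 1))) * Real.sqrt (4 * Real.pi))⁻¹) ^ (d + 1) / m2 := by
  set K : ℝ := ((2 * Real.sqrt (R ^ 2 / (4 * (d + 1))) * Real.sqrt (4 * Real.pi))⁻¹) ^ (d + 1) with hK
  have hE : IntegrableOn (fun t : ℝ => Real.exp (-m2 * t) * K) (Ioi (0 : ℝ)) := (exp_neg_integrableOn_Ioi 0 hm).mul_const K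
  unfold freePropRadial
  calc ∫ t in Ioi (0 : ℝ), Real.exp (-(t * m2)) * heatRadial d t R ≤ ∫ t in Ioi (0 : ℝ), Real.exp (-m2 * t) * K := by
        refine setIntegral_mono_on (integrableOn_exp_mul_heatRadial hm hR) hE measurableSet_Ioi fun t ht => ?_
        rw [show -(t * m2) = -m2 * t by ring]
        exact mul_le_mul_of_nonneg_left (heatRadial_le_inv_pow ht hR) (Real.exp_nonneg _)
    _ = K / m2 := by
        rw [integral_mul_const, integral_exp_mul_Ioi (by linarith) 0]
        simp only [mul_zero, Real.exp_zero]
        field_simp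

/-! ## §4 The sandwich -/

/-- King's proper-time density in tent form is integrable on `(0,∞)`. [folklore] -/
theorem integrableOn_tentForm {m2 : ℝ} (hm : 0 < m2) (z : Fin (d + 1) → ℤ) :
    IntegrableOn (fun t : ℝ => Real.exp (-(t * m2)) * ∏ μ, ∫ u : ℝ, tent 1 u * gaussLine t ((z μ : ℝ) - u)) (Ioi (0 : ℝ)) := by
  have h := (integrableOn_properTime hm z).mul_const (((2 * Real.pi) ^ (d + 1))⁻¹)
  refine h.congr ?_
  filter_upwards [ae_restrict_mem measurableSet_Ioi] with t ht
  have hμ : ∀ μ : Fin (d + 1), lineHeat t (z μ) = 2 * Real.pi * ∫ u : ℝ, tent 1 u * gaussLine t ((z μ : ℝ) - u) := fun μ => lineHeat_eq_integral_tent ht _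
  simp_rw [hμ]
  rw [Finset.prod_mul_distrib, Finset.prod_const, Finset.card_univ, Fintype.card_fin]
  have hπ : (2 * Real.pi) ^ (d + 1) ≠ 0 := by positivity
  field_simp

/-- ★★★ **UPPER COMPARISON**: if the blocks at `0` and `z` are separated (`R₋(z) > 0`, i.e. some `|z_μ| ≥ 2`), then `S₂^{ℝ}(z) ≤ C_m(R₋(z))` — King's continuum block two-point
function is at most the continuum free propagator at the SMALLEST distance between the two blocks. [cite: King1986, Thm 2.1 (2.22) p.654, (4.5) p.670, Thm 3.3 (3.6) p.655] -/
theorem kingS2Inf_le_freePropRadial {m2 : ℝ} (hm : 0 < m2) {z : Fin (d + 1) → ℤ} (hgap : 0 < blockGap z) :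
    kingS2Inf m2 z ≤ freePropRadial d m2 (blockGap z) := by
  rw [kingS2Inf_eq_integral_tent_gaussLine hm z, freePropRadial]
  refine setIntegral_mono_on (integrableOn_tentForm hm z) (integrableOn_exp_mul_heatRadial hm hgap) measurableSet_Ioi fun t ht => ?_
  exact mul_le_mul_of_nonneg_left (prod_tentAvg_le_heatRadial ht z) (Real.exp_nonneg _)

/-- ★★★ **LOWER COMPARISON**: for EVERY `z`, `C_m(R₊(z)) ≤ S₂^{ℝ}(z)` — at least the continuum free propagator at the LARGEST distance between the two blocks.
[cite: King1986, Thm 2.1 (2.22) p.654, (4.5) p.670, Thm 3.3 (3.6) p.655] -/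
theorem freePropRadial_le_kingS2Inf {m2 : ℝ} (hm : 0 < m2) (z : Fin (d + 1) → ℤ) : freePropRadial d m2 (blockSpan z) ≤ kingS2Inf m2 z := by
  rw [kingS2Inf_eq_integral_tent_gaussLine hm z, freePropRadial]
  refine setIntegral_mono_on (integrableOn_exp_mul_heatRadial hm (blockSpan_pos z)) (integrableOn_tentForm hm z) measurableSet_Ioi fun t ht => ?_
  exact mul_le_mul_of_nonneg_left (heatRadial_le_prod_tentAvg ht z) (Real.exp_nonneg _)

/-- ★★ **THE SANDWICH**: `C_m(R₊(z)) ≤ S₂^{ℝ}(z) ≤ C_m(R₋(z))` whenever `R₋(z) > 0`. [cite: King1986, Thm 2.1 (2.22) p.654, (4.5) p.670] -/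
theorem kingS2Inf_sandwich {m2 : ℝ} (hm : 0 < m2) {z : Fin (d + 1) → ℤ} (hgap : 0 < blockGap z) :
    freePropRadial d m2 (blockSpan z) ≤ kingS2Inf m2 z ∧ kingS2Inf m2 z ≤ freePropRadial d m2 (blockGap z) :=
  ⟨freePropRadial_le_kingS2Inf hm z, kingS2Inf_le_freePropRadial hm hgap⟩

/-! ## §5 The block radii against the Euclidean norm of `z` -/

/-- `‖z‖₂ = (Σ_μ z_μ²)^{1∕2}` for the image of `z` in `EuclideanSpace ℝ (Fin (d+1))`. [folklore] -/
theorem euclidNorm_eq (w : Fin (d + 1) → ℝ) : ‖WithLp.toLp 2 w‖ = Real.sqrt (∑ μ, w μ ^ 2) := by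
  rw [EuclideanSpace.norm_eq]
  congr 1
  exact Finset.sum_congr rfl fun μ _ => by rw [Real.norm_eq_abs, sq_abs]

/-- `‖(1,…,1)‖₂ = √(d+1)`. [folklore] -/
theorem euclidNorm_one : ‖WithLp.toLp 2 (fun _ : Fin (d + 1) => (1 : ℝ))‖ = Real.sqrt (d + 1) := by
  rw [euclidNorm_eq]
  simp

/-- ★ `R₊(z) ≤ ‖z‖₂ + √(d+1)` (Minkowski). [folklore] -/
theorem blockSpan_le_norm_add (z : Fin (d + 1) → ℤ) : blockSpan z ≤ ‖WithLp.toLp 2 (fun μ => (z μ : ℝ))‖ + Real.sqrt (d + 1) := by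
  have h := norm_add_le (WithLp.toLp 2 (fun μ => |(z μ : ℝ)|)) (WithLp.toLp 2 (fun _ : Fin (d + 1) => (1 : ℝ)))
  rw [← WithLp.toLp_add, euclidNorm_one, euclidNorm_eq, euclidNorm_eq] at h
  simp only [Pi.add_apply, sq_abs] at h
  rw [blockSpan, euclidNorm_eq]
  exact h

/-- ★ `‖z‖₂ − √(d+1) ≤ R₋(z)` (`|z_μ| ≤ (|z_μ|−1)₊ + 1` and Minkowski). [folklore] -/
theorem norm_sub_le_blockGap (z : Fin (d + 1) → ℤ) : ‖WithLp.toLp 2 (fun μ => (z μ : ℝ))‖ - Real.sqrt (d + 1) ≤ blockGap z := by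
  have h := norm_add_le (WithLp.toLp 2 (fun μ => max (|(z μ : ℝ)| - 1) 0)) (WithLp.toLp 2 (fun _ : Fin (d + 1) => (1 : ℝ)))
  rw [← WithLp.toLp_add, euclidNorm_one, euclidNorm_eq, euclidNorm_eq] at h
  simp only [Pi.add_apply] at h
  have hmono : ‖WithLp.toLp 2 (fun μ => (z μ : ℝ))‖ ≤ Real.sqrt (∑ μ, (max (|(z μ : ℝ)| - 1) 0 + 1) ^ 2) := by
    rw [euclidNorm_eq]
    refine Real.sqrt_le_sqrt (Finset.sum_le_sum fun μ _ => ?_)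
    rw [← sq_abs (z μ : ℝ)]
    refine pow_le_pow_left₀ (abs_nonneg _) ?_ 2
    have := le_max_left (|(z μ : ℝ)| - 1) 0
    linarith
  unfold blockGap
  linarith

end Summit.QuantumFields.YangMills.BalabanUVNodes.N15KingModelRung.ProperTime
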